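import Summits.QuantumAdvantage.QuantumAdvantage.Theorems.CubicForrelationNearExactIsExactTwelveTypeO512Above930
import Summits.QuantumAdvantage.QuantumAdvantage.Theorems.CubicForrelationNearExactIsExactTwelveTypeO960Above930
import Summits.QuantumAdvantage.QuantumAdvantage.Theorems.CubicForrelationNearExactIsExactTwelveTypeO512Above929
import Summits.QuantumAdvantage.QuantumAdvantage.Theorems.CubicForrelationNearExactIsExactTwelveTypeO960At930
import Summits.QuantumAdvantage.QuantumAdvantage.Theorems.CubicForrelationNearExactIsExactTwelveTypeO896DeadB
import Summits.QuantumAdvantage.QuantumAdvantage.Theorems.CubicForrelationNearExactIsExactTwelveLevelFive930Structure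
import Summits.QuantumAdvantage.QuantumAdvantage.Theorems.CubicForrelationNearExactIsExactTwelveLevelSixBothGt930
import Summits.QuantumAdvantage.QuantumAdvantage.Theorems.CubicForrelationNearExactIsExactKtThreeStructure

/-!
# Crux `CubicForrelation.NearExactIsExact` (stmt-QuantumAdvantage-14043) — n = 12, the TYPE-O branch below `932/1024`: above `29/32` the base set is
  `512` (only below `931/1024`), `960`, or `992` (only up to `930/1024`); above `930/1024` there is NO type-O side, both sides are at level `≥ 6`

Certificate seat `b2b-cforr-cert` (gen 19).  HONEST FRAMING: kernel-checked structure lemmas (standard axioms) for the type-O branch of the windows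
below `932/1024` at `n = 12` — nothing is closed here; NO new value of `θ₁₂`.  NOT summit progress.

For a type-O side (`W_g = 16u`, some `u` odd) of a cubic pair on 12 bits the base set `E = {d₁ = d₂}` (`d₁ = [⌊u/2⌋ odd]` affine,
`d₂ = [⌊u/4⌋ odd]` cubic) is the support of the cubic `d₁ ⊕ d₂ ⊕ 1`, and `4096 + 8·#E ≤ Σ τ² = 2¹⁷(1 − Φ)`.
* `to19_typeO_gt2932_shape` (`Φ > 29/32`): `#E = 512 ∧ Φ ≤ 931/1024`, or `#E = 960`, or `#E = 992 ∧ Φ ≤ 930/1024`.  Ingredients: the budget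
  gives `#E < 1024`; Kasami–Tokura for cubics (`…KtThreeStructure.kt3_weights_twelve`: the weights of `RM(3,12)` below `1024` are
  `0, 512, 768, 896, 960, 992`); `E ≠ ∅` (`TypeOTwelve.no_caseA`); `#E = 768 ⇒ Φ ≤ 29/32` (`to15_typeO_E768_le`, gen 15); `#E = 896 ⇒ Φ ≤ 29/32`
  (`to19_typeO_E896_le_2932`, gen 18's partner-level argument re-run with `Σ v² ≤ 63`); `#E = 512 ⇒ Φ ≤ 931/1024` (`to15_typeO_E_ge_768`).
* `to19_typeO_gt930_shape` (`Φ > 930/1024`): `#E = 512 ∧ Φ ≤ 931/1024`, or `#E = 960`; `Σ τ² < 12032`.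
* `to19_typeO_gt930_false` (`Φ > 930/1024`): NO type-O side at all — the 9-flat pattern forces `Φ = 931/1024` and dies through the
  partner's residues (`to19_typeO_E512_gt930_false`, `…TwelveTypeO512At931/Above930`), and the `960`-configuration with excess `< 256` dies
  because the partner identity forces `v̂ ∈ {0, ±8}` (`to19_typeO_E960_gt930_false'`, `…TwelveTypeO960At931/Above930`).
  **The type-O branch of the whole window `(930/1024, 932/1024)` is CLOSED.**
* `to19_window_gt930_levelSix`: consequently a cubic pair on 12 bits with `Φ > 930/1024` has BOTH sides at Ax level `≥ 6`
  (`W_f, W_g ∈ 64ℤ`; level 5 is dead above `930/1024` by `tw19_levelFive_gt_930_false`), with `Σ e² = 8192(1 − Φ) < 752` — the only branch of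
  the rungs `931/1024` (`Σ e² ≤ 744`) and `930.5/1024` still open (engine `…Eight751` and `…SigmaSupp` apply; missing: the off-flat trichotomy at
  off-`Z` energy `≤ 232` resp. `≤ 239`, cf. HOME/b2b-cforr-cert-g18/PLAN-N12-931.md).
* `to19_window_gt930_residual`: with `…TwelveLevelSixBothGt930` (gen 18's assembly re-run at budget `751` for off-flat energy `≤ 224`) the
  surviving pairs have off-flat energy `> 224` ON BOTH SIDES — i.e. `Σ_{x∉Z_g} e_g² , Σ_{y∉Z_f} e_f² ∈ {228, 232, 236}`.  This is the precise
  residual of the windows `(930/1024, 932/1024)` at `n = 12`.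

References: T. Kasami, N. Tokura (1970) Thm 1; MacWilliams–Sloane (1977) Ch. 15.  Axioms: the standard three.
-/

set_option linter.dupNamespace false -- D-0017: single-problem summit ⇒ `QuantumAdvantage.QuantumAdvantage` by design

noncomputable section

namespace Summit.QuantumAdvantage.QuantumAdvantage.Theorems.CubicForrelation.NearExactIsExact

open Finset
open Literature.Computability.QuantumComplexity
open Literature.Computability.QuantumComplexity.BuzetChailloux (bxor zeroVec bxor_bxor_cancel_left bxor_zeroVec zeroVec_bxor bxor_comm
  bxor_self twist_zeroVec_right twist_bxor_right)
open Literature.Computability.QuantumComplexity.DerivativeWalsh (W)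
open Summit.QuantumAdvantage.QuantumAdvantage.Theorems.NearExactIsExact.Negative (TypeOTwelve.typeO_of_exists_odd TypeOTwelve.no_caseA)

/-- **Shape of a type-O side above `29/32`: base set `512`, `960` or `992`; `512` only at `Φ ≤ 931/1024`, `992` only at `Φ ≤ 930/1024`;
and the budget `4096 + 8·#E ≤ Σ τ² = 2¹⁷(1 − Φ)`.**  (Kasami–Tokura for cubics on 12 bits, `kt3_weights_twelve`, applied to the cubic
`d₁ ⊕ d₂ ⊕ 1` whose support is `E`; `#E = 768` and `#E = 896` are excluded by `to15_typeO_E768_le` and `to19_typeO_E896_le_2932`, `E ≠ ∅` by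
`TypeOTwelve.no_caseA`.)  Covers the type-O branch of every rung from `931/1024` down to `929/1024`.  NOT summit progress. [this work] -/
theorem to19_typeO_gt2932_shape (f g : (Fin (6 + 6) → Bool) → Bool) (hf : IsDegLeFun 3 f) (hg : IsDegLeFun 3 g)
    (u : (Fin (6 + 6) → Bool) → ℤ) (hu : ∀ x, W (fun y => signOf (g y)) x = (2 : ℝ) ^ 4 * (u x : ℝ))
    (hodd : ∃ x, Odd (u x)) (hΦ : (29 / 32 : ℝ) < forrelation f g) :
    ((#(univ.filter fun x : Fin (6 + 6) → Bool => (Odd (u x / 2) ↔ Odd (u x / 2 / 2))) = 512 ∧ forrelation f g ≤ 931 / 1024) ∨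
      #(univ.filter fun x : Fin (6 + 6) → Bool => (Odd (u x / 2) ↔ Odd (u x / 2 / 2))) = 960 ∨
      (#(univ.filter fun x : Fin (6 + 6) → Bool => (Odd (u x / 2) ↔ Odd (u x / 2 / 2))) = 992 ∧ forrelation f g ≤ 930 / 1024)) ∧
    4096 + 8 * (#(univ.filter fun x : Fin (6 + 6) → Bool => (Odd (u x / 2) ↔ Odd (u x / 2 / 2))) : ℤ) ≤
      (∑ x, (u x - 4 * sZ (f x)) ^ 2 : ℤ) ∧
    ((∑ x, (u x - 4 * sZ (f x)) ^ 2 : ℤ) : ℝ) = (2 : ℝ) ^ 17 * (1 - forrelation f g) := by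
  classical
  have hall : ∀ x, Odd (u x) := TypeOTwelve.typeO_of_exists_odd g u hg hu hodd
  have hu' : ∀ x, W (fun y => signOf (g y)) x = (2 : ℝ) ^ (2 * 2) * (u x : ℝ) := fun x => (hu x).trans (by norm_num)
  have hd1 : IsDegLeFun 1 (fun x => decide (Odd (u x / 2))) := z2_digitOne 2 g u hg hu' hall
  have hd2 : IsDegLeFun 3 (fun x => decide (Odd (u x / 2 / 2))) := z2_digitTwo 2 g u hg hu' hall
  set E := univ.filter (fun x : Fin (6 + 6) → Bool => (Odd (u x / 2) ↔ Odd (u x / 2 / 2))) with hEdef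
  have hdegE : IsDegLeFun (2 + 1) (fun x => (decide (Odd (u x / 2)) ^^ decide (Odd (u x / 2 / 2))) ^^ true) :=
    tb_isDegLeFun_xor_const (bb_isDegLeFun_bxor (hd1.mono (by norm_num)) hd2) true
  have hsetE : (univ.filter fun x : Fin (6 + 6) → Bool =>
      ((decide (Odd (u x / 2)) ^^ decide (Odd (u x / 2 / 2))) ^^ true) = true) = E := by
    rw [hEdef]
    apply filter_congr
    intro x _
    by_cases h1 : Odd (u x / 2) <;> by_cases h2 : Odd (u x / 2 / 2) <;> simp [h1, h2]
  have hsumE : (∑ x, (if (Odd (u x / 2) ↔ Odd (u x / 2 / 2)) then 1 else 0 : ℤ)) = #E := by rw [sum_boole]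
  -- `E ≠ ∅` (case A is empty)
  have hEpos : 0 < #E := by
    by_contra h0
    have hE0 : #E = 0 := by omega
    refine TypeOTwelve.no_caseA g u hg hu fun x => ?_
    have hx : x ∉ E := by rw [card_eq_zero] at hE0; rw [hE0]; exact notMem_empty x
    rw [hEdef, mem_filter] at hx
    have h0 := Int.odd_iff.1 (hall x)
    have hx' : ¬ (Odd (u x / 2) ↔ Odd (u x / 2 / 2)) := fun h => hx ⟨mem_univ _, h⟩
    rw [Int.odd_iff, Int.odd_iff] at hx'
    omega
  -- budget: `4096 + 8#E ≤ Σ τ² = 2¹⁷(1 − Φ) < 12288`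
  have hbud := tw12_budget f g u hu
  have hT : (∑ x, (u x - 4 * sZ (f x)) ^ 2 : ℤ) < 12288 := by
    have h' : ((∑ x, (u x - 4 * sZ (f x)) ^ 2 : ℤ) : ℝ) < 12288 := by rw [hbud]; linarith
    exact_mod_cast h'
  choose v hv using fun x => to12_pt_mod8 (u x) (sZ (f x)) (hall x) (tp_sZ_cases (f x))
  set τ₀ : (Fin (6 + 6) → Bool) → ℤ := fun x =>
    sZ (decide (Odd (u x / 2))) * (1 - 4 * (if (Odd (u x / 2) ↔ Odd (u x / 2 / 2)) then 1 else 0)) with hτ₀def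
  have hτ₀val : ∀ x, τ₀ x = 1 ∨ τ₀ x = -1 ∨ τ₀ x = 3 ∨ τ₀ x = -3 := by
    intro x
    simp only [τ₀]
    rcases tp_sZ_cases (decide (Odd (u x / 2))) with h | h <;> rw [h] <;> split_ifs <;> norm_num
  have hτ₀sq : ∀ x, τ₀ x ^ 2 = 1 + 8 * (if (Odd (u x / 2) ↔ Odd (u x / 2 / 2)) then 1 else 0 : ℤ) := by
    intro x
    simp only [τ₀]
    rcases tp_sZ_cases (decide (Odd (u x / 2))) with h | h <;> rw [h] <;> split_ifs <;> norm_num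
  have hsumτ₀ : ∑ x, τ₀ x ^ 2 = 4096 + 8 * #E := by
    rw [sum_congr rfl fun x _ => hτ₀sq x, sum_add_distrib, ← mul_sum, hsumE, sum_const, card_univ, Fintype.card_fun,
      Fintype.card_bool, Fintype.card_fin]
    norm_num
  have hTge : ∑ x, τ₀ x ^ 2 ≤ (∑ x, (u x - 4 * sZ (f x)) ^ 2 : ℤ) := by
    refine sum_le_sum fun x _ => ?_
    rw [hv x]
    linarith [to12_excess_nonneg (τ₀ x) (v x) (hτ₀val x)]
  rw [hsumτ₀] at hTge
  have hE1023 : #E < 1024 := by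
    have : (8 : ℤ) * #E < 8192 := by linarith
    have : 8 * #E < 8192 := by exact_mod_cast this
    omega
  refine ⟨?_, hTge, hbud⟩
  -- Kasami–Tokura for cubics on 12 bits: `#E ∈ {0, 512, 768, 896, 960, 992}`
  have hKT := kt3_weights_twelve _ hdegE (by rw [hsetE]; exact hE1023)
  rw [hsetE] at hKT
  rcases hKT with h | h | h | h | h | h
  · omega
  · -- `#E = 512` needs `Φ ≤ 931/1024`
    left
    refine ⟨h, ?_⟩
    by_contra hgt
    push Not at hgt
    have := to15_typeO_E_ge_768 f g hf hg u hu hodd hgt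
    rw [← hEdef] at this
    omega
  · -- `#E = 768` forces `Φ ≤ 29/32`
    exfalso
    have := to15_typeO_E768_le f g hf hg u hu hodd h
    linarith
  · -- `#E = 896` forces `Φ ≤ 29/32`
    exfalso
    have := to19_typeO_E896_le_2932 f g hf hg u hu hodd h
    linarith
  · exact Or.inr (Or.inl h)
  · -- `#E = 992` exhausts the budget below `930/1024`
    right; right
    refine ⟨h, ?_⟩
    rw [h] at hTge
    have h1 : (12032 : ℤ) ≤ ∑ x, (u x - 4 * sZ (f x)) ^ 2 := by push_cast at hTge; linarith
    have h' : (12032 : ℝ) ≤ ((∑ x, (u x - 4 * sZ (f x)) ^ 2 : ℤ) : ℝ) := by exact_mod_cast h1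
    rw [hbud] at h'
    linarith

/-- **Shape of a type-O side above `930/1024`: base set `512` or `960`, budget `Σ τ² < 12032`, and `512` only at `Φ ≤ 931/1024`.**
See the module docstring.  NOT summit progress. [this work] -/
theorem to19_typeO_gt930_shape (f g : (Fin (6 + 6) → Bool) → Bool) (hf : IsDegLeFun 3 f) (hg : IsDegLeFun 3 g)
    (u : (Fin (6 + 6) → Bool) → ℤ) (hu : ∀ x, W (fun y => signOf (g y)) x = (2 : ℝ) ^ 4 * (u x : ℝ))
    (hodd : ∃ x, Odd (u x)) (hΦ : (930 / 1024 : ℝ) < forrelation f g) :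
    ((#(univ.filter fun x : Fin (6 + 6) → Bool => (Odd (u x / 2) ↔ Odd (u x / 2 / 2))) = 512 ∧ forrelation f g ≤ 931 / 1024) ∨
      #(univ.filter fun x : Fin (6 + 6) → Bool => (Odd (u x / 2) ↔ Odd (u x / 2 / 2))) = 960) ∧
    (∑ x, (u x - 4 * sZ (f x)) ^ 2 : ℤ) < 12032 := by
  obtain ⟨h, -, hbud⟩ := to19_typeO_gt2932_shape f g hf hg u hu hodd (by linarith)
  refine ⟨?_, ?_⟩
  · rcases h with h | h | ⟨-, hle⟩
    · exact Or.inl h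
    · exact Or.inr h
    · exfalso; linarith
  · have h' : ((∑ x, (u x - 4 * sZ (f x)) ^ 2 : ℤ) : ℝ) < 12032 := by rw [hbud]; linarith
    exact_mod_cast h'

/-- **No type-O side above `930/1024`.**  Cubic `f, g` on 12 bits with `W_g = 16u`, some `u(x)` odd, and `Φ(f,g) > 930/1024` do not
exist: the base set would be `512` or `960` (`to19_typeO_gt930_shape`), and both are impossible above `930/1024`
(`to19_typeO_E512_gt930_false`, `to19_typeO_E960_gt930_false'`).  Finite-slice statement; NOT summit progress. [this work] -/
theorem to19_typeO_gt930_false (f g : (Fin (6 + 6) → Bool) → Bool) (hf : IsDegLeFun 3 f) (hg : IsDegLeFun 3 g)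
    (u : (Fin (6 + 6) → Bool) → ℤ) (hu : ∀ x, W (fun y => signOf (g y)) x = (2 : ℝ) ^ 4 * (u x : ℝ))
    (hodd : ∃ x, Odd (u x)) (hΦ : (930 / 1024 : ℝ) < forrelation f g) : False := by
  rcases (to19_typeO_gt930_shape f g hf hg u hu hodd hΦ).1 with ⟨h512, -⟩ | h960
  · exact to19_typeO_E512_gt930_false f g hf hg u hu hodd h512 hΦ
  · exact to19_typeO_E960_gt930_false' f g hf hg u hu hodd h960 hΦ

/-- **Above `930/1024` both sides are at level `≥ 6`.**  A cubic pair on 12 bits with `Φ > 930/1024` has BOTH Walsh spectra in `64ℤ`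
(`W_f = 64w_f`, `W_g = 64w_g`): type O is dead above `930/1024` (`to19_typeO_gt930_false`, both orders) and so is level 5
(`tw19_levelFive_gt_930_false`).  With `Σ e² = 8192(1 − Φ) < 752` this is the one branch of the window `(930/1024, 932/1024)` still open.
(For `Φ = 1` the statement is also true and uninteresting.)  Finite-slice statement; NOT summit progress. [this work] -/
theorem to19_window_gt930_levelSix (f g : (Fin (6 + 6) → Bool) → Bool) (hf : IsDegLeFun 3 f) (hg : IsDegLeFun 3 g)
    (hlo : (930 / 1024 : ℝ) < forrelation f g) :
    (∃ w : (Fin (6 + 6) → Bool) → ℤ, ∀ x, W (fun y => signOf (g y)) x = (2 : ℝ) ^ 6 * (w x : ℝ)) ∧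
    (∃ w : (Fin (6 + 6) → Bool) → ℤ, ∀ y, W (fun x => signOf (f x)) y = (2 : ℝ) ^ 6 * (w y : ℝ)) := by
  have hΦ' : forrelation g f = forrelation f g := by
    rw [Summit.QuantumAdvantage.QuantumAdvantage.Theorems.SignedCubicForrelationNotPrBPP.Negative.HalfQuad.forrelation_comm]
  have hlo' : (930 / 1024 : ℝ) < forrelation g f := by rw [hΦ']; exact hlo
  have key : ∀ (a b : (Fin (6 + 6) → Bool) → Bool), IsDegLeFun 3 a → IsDegLeFun 3 b → (930 / 1024 : ℝ) < forrelation a b →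
      ∃ w : (Fin (6 + 6) → Bool) → ℤ, ∀ x, W (fun y => signOf (b y)) x = (2 : ℝ) ^ 6 * (w x : ℝ) := by
    intro a b ha hb hab
    obtain ⟨ub, hub⟩ := tw_base (n := 6 + 6) b hb 4 (by norm_num)
    have hO : ∀ x, ¬ Odd (ub x) := fun x hx => to19_typeO_gt930_false a b ha hb ub hub ⟨x, hx⟩ hab
    have hub5 := tw_level_up (j := 4) b ub hub hO
    have h5 : ∀ x, ¬ Odd (ub x / 2) := fun x hx => tw19_levelFive_gt_930_false a b ha hb (fun x => ub x / 2) hub5 ⟨x, hx⟩ hab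
    exact ⟨fun x => ub x / 2 / 2, tw_level_up (j := 5) b (fun x => ub x / 2) hub5 h5⟩
  exact ⟨key f g hf hg hlo, key g f hg hf hlo'⟩

/-- **Packaging at `Fin 12`**: every cubic pair on 12 bits with `Φ > 930/1024` has `W_f, W_g ∈ 64ℤ` (both sides at Ax level `≥ 6`).
NOT summit progress. [this work] -/
theorem window_gt930_levelSix_twelve : ∀ f g : (Fin 12 → Bool) → Bool, IsDegLeFun 3 f → IsDegLeFun 3 g →
    (930 / 1024 : ℝ) < forrelation f g →
    (∃ w : (Fin 12 → Bool) → ℤ, ∀ x, W (fun y => signOf (g y)) x = 64 * (w x : ℝ)) ∧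
    (∃ w : (Fin 12 → Bool) → ℤ, ∀ y, W (fun x => signOf (f x)) y = 64 * (w y : ℝ)) := by
  intro f g hf hg hlo
  obtain ⟨⟨wg, hwg⟩, ⟨wf, hwf⟩⟩ := to19_window_gt930_levelSix f g hf hg hlo
  exact ⟨⟨wg, fun x => (hwg x).trans (by norm_num)⟩, ⟨wf, fun y => (hwf y).trans (by norm_num)⟩⟩

/-- **The residual of the window `(930/1024, 1)` at `n = 12`.**  A cubic pair on 12 bits with `930/1024 < Φ < 1` has both sides at level
`≥ 6` (`W_g = 64u''`, `W_f = 64w`), and on BOTH sides the residual's off-flat energy exceeds `224`: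
`Σ_{x : u''(x) odd} (u''(x) − (−1)^{f(x)})² > 224` and `Σ_{y : w(y) odd} (w(y) − (−1)^{g(y)})² > 224` (`to19_levelSix_both_gt930_offZ224_false`
in both orders).  With `Σ e² < 752` and `Σ_Z e² ≥ 512` these energies lie in `(224, 239]`.  Finite-slice statement; NO new value of `θ₁₂`;
NOT summit progress. [this work] -/
theorem to19_window_gt930_residual (f g : (Fin (6 + 6) → Bool) → Bool) (hf : IsDegLeFun 3 f) (hg : IsDegLeFun 3 g)
    (hlo : (930 / 1024 : ℝ) < forrelation f g) (hhi : forrelation f g < 1) :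
    ∃ (u'' w : (Fin (6 + 6) → Bool) → ℤ),
      (∀ x, W (fun y => signOf (g y)) x = (2 : ℝ) ^ 6 * (u'' x : ℝ)) ∧ (∀ y, W (fun x => signOf (f x)) y = (2 : ℝ) ^ 6 * (w y : ℝ)) ∧
      224 < ∑ x ∈ univ.filter (fun x => x ∉ (univ.filter fun x : Fin (6 + 6) → Bool => ¬ Odd (u'' x))), (u'' x - sZ (f x)) ^ 2 ∧
      224 < ∑ y ∈ univ.filter (fun y => y ∉ (univ.filter fun y : Fin (6 + 6) → Bool => ¬ Odd (w y))), (w y - sZ (g y)) ^ 2 := by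
  obtain ⟨⟨u'', hu''⟩, ⟨w, hw⟩⟩ := to19_window_gt930_levelSix f g hf hg hlo
  have hΦ' : forrelation g f = forrelation f g := by
    rw [Summit.QuantumAdvantage.QuantumAdvantage.Theorems.SignedCubicForrelationNotPrBPP.Negative.HalfQuad.forrelation_comm]
  refine ⟨u'', w, hu'', hw, ?_, ?_⟩
  · by_contra h
    push Not at h
    exact to19_levelSix_both_gt930_offZ224_false f g hf hg u'' hu'' w hw hlo hhi h
  · by_contra h
    push Not at h
    exact to19_levelSix_both_gt930_offZ224_false g f hg hf w hw u'' hu'' (by rw [hΦ']; exact hlo) (by rw [hΦ']; exact hhi) h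

/-! ### Appended (gen 19, later the same day): the boundary value `Φ = 930/1024` -/

/-- **Type O at `Φ ≥ 930/1024`: base set `992`, ZERO excess, `Φ = 930/1024` exactly.**  Cubic `f, g` on 12 bits, `W_g = 16u`, some `u(x)`
odd, `Φ(f,g) ≥ 930/1024` ⇒ `#E = 992`, `Σ_x (u − 4(−1)^f)² = 12032 = 4096 + 8·992` and `Φ = 930/1024`: the base sets `512` (`to19_typeO_E512_gt929_false`,
`…TwelveTypeO512Above929`) and `960` (`to19_typeO_E960_ge930_false'`, `…TwelveTypeO960At930`) are dead at `Φ ≥ 930/1024`.  This is the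
analogue, one 2-adic level up, of gen 18's `T1` configuration (`960`, zero excess, at `932/1024`); by `kt3_structure_twelve` the base set is
`H ∩ {q = 1}` for an affine hyperplane `H` and a quadratic `q`.  Finite-slice statement; NO new value of `θ₁₂`; NOT summit progress. [this work] -/
theorem to19_typeO_ge930_shape (f g : (Fin (6 + 6) → Bool) → Bool) (hf : IsDegLeFun 3 f) (hg : IsDegLeFun 3 g)
    (u : (Fin (6 + 6) → Bool) → ℤ) (hu : ∀ x, W (fun y => signOf (g y)) x = (2 : ℝ) ^ 4 * (u x : ℝ))
    (hodd : ∃ x, Odd (u x)) (hΦ : (930 / 1024 : ℝ) ≤ forrelation f g) :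
    #(univ.filter fun x : Fin (6 + 6) → Bool => (Odd (u x / 2) ↔ Odd (u x / 2 / 2))) = 992 ∧
    (∑ x, (u x - 4 * sZ (f x)) ^ 2 : ℤ) = 12032 ∧ forrelation f g = 930 / 1024 := by
  obtain ⟨h, hge, hbud⟩ := to19_typeO_gt2932_shape f g hf hg u hu hodd (by linarith)
  rcases h with ⟨h512, -⟩ | h960 | ⟨h992, hle⟩
  · exact (to19_typeO_E512_gt929_false f g hf hg u hu hodd h512 (by linarith)).elim
  · exact (to19_typeO_E960_ge930_false' f g hf hg u hu hodd h960 hΦ).elim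
  · have hΦeq : forrelation f g = 930 / 1024 := le_antisymm hle hΦ
    refine ⟨h992, ?_, hΦeq⟩
    rw [h992] at hge
    have h1 : ((∑ x, (u x - 4 * sZ (f x)) ^ 2 : ℤ) : ℝ) = 12032 := by rw [hbud, hΦeq]; norm_num
    exact_mod_cast h1

/-- **Type O above `929/1024`: base set `960` (then `Φ < 930/1024`) or `992` (then `Φ ≤ 930/1024`).**  Cubic `f, g` on 12 bits,
`W_g = 16u`, some `u(x)` odd, `Φ > 929/1024`: the 9-flat pattern is dead (`to19_typeO_E512_gt929_false`) and `960` is dead from `930/1024` on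
(`to19_typeO_E960_ge930_false'`).  The shape lemma for the rungs `930` and `929.5`.  NOT summit progress. [this work] -/
theorem to19_typeO_gt929_shape (f g : (Fin (6 + 6) → Bool) → Bool) (hf : IsDegLeFun 3 f) (hg : IsDegLeFun 3 g)
    (u : (Fin (6 + 6) → Bool) → ℤ) (hu : ∀ x, W (fun y => signOf (g y)) x = (2 : ℝ) ^ 4 * (u x : ℝ))
    (hodd : ∃ x, Odd (u x)) (hΦ : (929 / 1024 : ℝ) < forrelation f g) :
    (#(univ.filter fun x : Fin (6 + 6) → Bool => (Odd (u x / 2) ↔ Odd (u x / 2 / 2))) = 960 ∧ forrelation f g < 930 / 1024) ∨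
    (#(univ.filter fun x : Fin (6 + 6) → Bool => (Odd (u x / 2) ↔ Odd (u x / 2 / 2))) = 992 ∧ forrelation f g ≤ 930 / 1024) := by
  obtain ⟨h, -, -⟩ := to19_typeO_gt2932_shape f g hf hg u hu hodd (by linarith)
  rcases h with ⟨h512, -⟩ | h960 | ⟨h992, hle⟩
  · exact (to19_typeO_E512_gt929_false f g hf hg u hu hodd h512 hΦ).elim
  · left
    refine ⟨h960, ?_⟩
    by_contra h930
    push Not at h930
    exact to19_typeO_E960_ge930_false' f g hf hg u hu hodd h960 h930
  · exact Or.inr ⟨h992, hle⟩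

/-- **Packaging at `Fin 12`** (appended, gen 20): a type-O side (`W_g = 16u`, some `u` odd) at `Φ ≥ 930/1024` has base set `#E = 992`, zero
excess (`Σ (u − 4(−1)^f)² = 12032`) and `Φ = 930/1024` exactly.  NOT summit progress. [this work; index only] -/
theorem typeO_ge930_shape_twelve : ∀ f g : (Fin 12 → Bool) → Bool, IsDegLeFun 3 f → IsDegLeFun 3 g →
    ∀ u : (Fin 12 → Bool) → ℤ, (∀ x, W (fun y => signOf (g y)) x = 16 * (u x : ℝ)) → (∃ x, Odd (u x)) →
    (930 / 1024 : ℝ) ≤ forrelation f g →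
    #(univ.filter fun x : Fin 12 → Bool => (Odd (u x / 2) ↔ Odd (u x / 2 / 2))) = 992 ∧
    (∑ x, (u x - 4 * sZ (f x)) ^ 2 : ℤ) = 12032 ∧ forrelation f g = 930 / 1024 :=
  fun f g hf hg u hu hodd hΦ => to19_typeO_ge930_shape f g hf hg u (fun x => (hu x).trans (by norm_num)) hodd hΦ

end Summit.QuantumAdvantage.QuantumAdvantage.Theorems.CubicForrelation.NearExactIsExact

end
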